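import Summits.NavierStokesRegularity.NavierStokesRegularity.Theses.PeriodicPortability
import Literature.Analysis.FluidPDE.NSLerayHopf
import HarnessLib.Audit

/-!
# Birth skeleton (BC3) of the crux `PeriodicPortability.ClayB`

(crux item `stmt-NavierStokesRegularity-16045`, rank 9, kind crux by `kind.auto-crux` — THE DECLARED
CONDITION of the conditional bridge `route-NavierStokesRegularity-PeriodicPortability`; tree path
`Cruxes/ClayB/Lines/birth.lean`; registrar `planner-skel-stmt-NavierStokesRegularity-16045-0`,
2026-08-17, route re-audit bin REPAIRABLE. No `Disproof.lean` exists for this crux (crux dir empty at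
registration); negatives index read 2026-08-17: 4 refuted statements on the summit, none about periodic
a priori bounds or the periodic Cauchy problem.)

THE CRUX. `ClayB` is printed Clay (B) verbatim (`ClayB ↔
Literature.Analysis.FluidPDE.NavierStokesExistenceSmoothPeriodic` is `Iff.rfl`, grounder g51-1): for every
`ν > 0` and every smooth divergence-free `ℤ³`-periodic datum `u₀ : ℝ³ → ℝ³` there are `u`, `p` jointly
smooth on `ℝ³ × [0,∞)` solving (1)(2)(3) with `f ≡ 0`, `u(·,t)` periodic (pressure unconstrained, as
printed). It is a registered OPEN CONJECTURE and the route never staffs it; this file only certifies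
that the condition has a typed two-layer anatomy (BC3), it claims no progress on (B).

THE CUT = the canonical anatomy of a global-regularity statement, typed in the NORMALISED periodic
class (velocity AND pressure slices `ℤ³`-periodic — the CMI-errata class; this matters, see the
Galilean remark below) and at the CRITICAL level `L³(unit cell)`:

* `stub_periodicLocalDichotomy` [KNOWN, size L to formalise: Fujita–Kato / Galerkin local theory on
  `𝕋³` with smoothness up to `t = 0` for smooth data (Robinson–Rodrigo–Sadowski 2016 Thm 6.8, §7.2;
  Temam 1995 §3), the `L^∞` restart step (tree: `Torus.exists_classicalNS_of_bounded_data`, KNSS 2009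
  §4) and uniqueness in the normalised class (tree: `Torus.IsClassicalNSSolutionOn.velocity_unique`),
  lifted to `ℝ³` (tree: `IsClassicalNSSolutionOn.of_torus_holds`)]: from a smooth divergence-free
  periodic datum, EITHER a global classical solution on `[0,∞)` with periodic velocity and pressure
  issues, OR there is a finite `T > 0` and a classical normalised solution on `[0,T)` from the datum
  whose velocity is unbounded on `[0,T) × ℝ³` (the maximal solution and the sup-norm blow-up
  alternative). Why it might fail: it should not (textbook); formalisation risk only (joint `C^∞` up to
  `t = 0` within `Ico 0 T`, one-sided time derivative).
* `stub_periodicCriticalEndpoint` [KNOWN, deep, size XL: the Escauriaza–Seregin–Šverák `L^{3,∞}`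
  endpoint in its LOCAL form (ESS 2003, Russ. Math. Surveys 58, Thm 1.4: a suitable weak solution in a
  parabolic cylinder with `v ∈ L_{3,∞}` is Hölder continuous up to the top of the half cylinder),
  applied on finitely many cylinders covering the cell below the final time; suitability of the smooth
  normalised solution up to `T` comes from the torus energy identity (`∫₀ᵀ‖∇u‖²_{L²(cell)} ≤
  ‖u(0)‖²/(2ν)`, periodic pressure does no work) and the Calderón–Zygmund bound
  `‖p − p̄(t)‖_{L^{3/2}(cell)} ≲ ‖u‖²_{L³(cell)}` for the mean-free periodic pressure; whole-space twin in
  tree: `Literature.Analysis.FluidPDE.ess_endpoint` (ns.S08)]: a classical normalised periodic solution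
  on `[0,T)` whose `L³(unit cell)` norm is bounded on `[0,T)` has bounded velocity on `[0,T) × ℝ³`.
  Why it might fail: it should not; the port of ESS to the periodic setting is by localisation, the
  risk is the size of the formalisation (backward uniqueness + unique continuation).
* `stub_periodicAPrioriL3` [OPEN — THIS IS WHERE CLAY (B) LIVES; conjecture-grade]: every classical
  normalised periodic solution on a finite window `[0,T)` has `L³(unit cell)` norm bounded on `[0,T)`
  (an a priori bound of the critical norm; the form in which (B) is usually attacked — Seregin 2012
  Thm 1.1 / ESS 2003: blow-up forces the critical `L³` norm to diverge, cf. the catalogued barrier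
  `Literature.Barriers.NavierStokesRegularity.CriticalNormBlowupNecessity`, and Tao 2011
  (arXiv:1108.1165) Thm 1.20 for the `H¹`-level twins Conj. 1.9 ⇔ 1.10 of this a-priori-bound
  reformulation). It is implied back by `ClayB` only through real mathematics (Galilean normalisation of
  the printed solution's pressure, torus uniqueness `velocity_unique`, compactness of `[0,T] × cell`),
  so it is (B) in a priori form, neither weaker nor cheaper — honest for a declared condition.
  Why it might fail: exactly as (B) might — a finite-time periodic singularity (none is known; Tao's
  averaged-equation blow-up, barrier `TaoAveragedBlowup`, shows no energy-level argument can prove it).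

GALILEAN REMARK (why both window stubs require the PRESSURE slices periodic). In the printed class
(pressure free) the window statements would be false/vacuous: `u(t,x) = c + a(t)`, `p = −a'(t)·x` is a
classical solution from the constant datum `c` for any smooth `a` with `a(0) = 0`, unbounded on `[0,T)`
if `a(t) → ∞` (Tao 2011 Prop. 7; NSWave0 module docstring; the route's barrier note on
`ForcedLerayHopfNonuniquenessNarrow`). With `p(t)` periodic, `∫_cell ∇p = 0` kills the drift, the
normalised class is unique (tree `Torus.IsClassicalNSSolutionOn.velocity_unique`) and the cell mean of
`u` is conserved (tree `PeriodicClassicalDescent`). The global branch of the dichotomy delivers a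
solution with periodic pressure as well, i.e. the errata form of (B), which implies the printed form
(tree `NavierStokesExistenceSmoothPeriodic.of_pressurePeriodic`); here the implication is inlined.

COMPOSITION. `ClayB_of : ClayB` — the ONLY theorem of this file concluding the crux, BY NAME, no `Prop`
hypotheses — is the real proof using the three stubs by name: run the dichotomy (stub 1); in the global
branch convert with the PROVED bridge `isNavierStokesSolution_and_smooth_iff` (NSLerayHopf); in the
finite branch the a priori `L³` bound (stub 3) feeds the critical endpoint (stub 2), whose velocity bound
contradicts the unboundedness clause. `sorry` occurs ONLY inside the three `stub_*`. The CLOSED twin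
`ClayB_of_hyps : S₁ → S₂ → S₃ → ClayB` (stub statements as hypotheses; zero placeholders, axioms
propext/Classical.choice/Quot.sound) is the registrar's folder evidence `bc/ClayB_birth_closed.lean`.

The import `Literature.Analysis.FluidPDE.NSLerayHopf` (for the proved bridge) is deliberately NOT in
the route file (rev 6/7 keep the route cone free of the Leray–Hopf named facts); it is proved tree
machinery used by the LINE, as the route header prescribes for helpers.

BC3 PROBES (registrar folder `bc/probe_*.lean`): for each stub statement `S`, `S → ClayB` and
`S → NavierStokesRegularity` by `first | exact? | simpa | aesop` FAIL; converses `ClayB → S` recorded in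
`Lines/birth.md`.
-/

noncomputable section

open Set MeasureTheory

namespace Summit.NavierStokesRegularity.NavierStokesRegularity.Cruxes.ClayB.Birth

set_option linter.unusedVariables false
set_option linter.dupNamespace false

/-- **stub 1 — `stub_periodicLocalDichotomy` (KNOWN; periodic local theory + sup-norm blow-up
alternative, normalised class, smooth up to `t = 0`).** For `ν > 0` and a smooth divergence-free
`ℤ³`-periodic datum `u₀` on `ℝ³`: EITHER there is a classical solution `(u,p)` of unforced NS_ν on
`ℝ³ × [0,∞)` with `u 0 = u₀` and `u(t)`, `p(t)` periodic for all `t ≥ 0`, OR there are `0 < T < ∞` and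
a classical solution `(u,p)` on `ℝ³ × [0,T)` with `u 0 = u₀`, `u(t)`, `p(t)` periodic on `[0,T)`, whose
velocity is unbounded on `[0,T) × ℝ³`. (Robinson–Rodrigo–Sadowski 2016 Thm 6.8/§7.2; KNSS 2009 §4;
tree: `Torus.exists_classicalNS_of_bounded_data`, `Torus.IsClassicalNSSolutionOn.velocity_unique`,
`IsClassicalNSSolutionOn.of_torus_holds`.) -/
theorem stub_periodicLocalDichotomy :
    ∀ ν : ℝ, 0 < ν → ∀ u₀ : EuclideanSpace ℝ (Fin 3) → EuclideanSpace ℝ (Fin 3),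
      ContDiff ℝ (⊤ : ℕ∞) u₀ → Literature.Analysis.FluidPDE.NSWave0.IsDivFree u₀ →
      Literature.Analysis.FluidPDE.IsLatticePeriodic u₀ →
      (∃ (u : ℝ → EuclideanSpace ℝ (Fin 3) → EuclideanSpace ℝ (Fin 3))
          (p : ℝ → EuclideanSpace ℝ (Fin 3) → ℝ),
          Literature.Analysis.FluidPDE.IsClassicalNSSolutionOn (Set.Ici 0) ν 0 u p ∧ u 0 = u₀ ∧
          (∀ t, 0 ≤ t → Literature.Analysis.FluidPDE.IsLatticePeriodic (u t)) ∧
          (∀ t, 0 ≤ t → Literature.Analysis.FluidPDE.IsLatticePeriodic (p t))) ∨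
      (∃ T : ℝ, 0 < T ∧ ∃ (u : ℝ → EuclideanSpace ℝ (Fin 3) → EuclideanSpace ℝ (Fin 3))
          (p : ℝ → EuclideanSpace ℝ (Fin 3) → ℝ),
          Literature.Analysis.FluidPDE.IsClassicalNSSolutionOn (Set.Ico 0 T) ν 0 u p ∧ u 0 = u₀ ∧
          (∀ t ∈ Set.Ico 0 T, Literature.Analysis.FluidPDE.IsLatticePeriodic (u t)) ∧
          (∀ t ∈ Set.Ico 0 T, Literature.Analysis.FluidPDE.IsLatticePeriodic (p t)) ∧
          ∀ M : ℝ, ∃ t ∈ Set.Ico 0 T, ∃ x, M < ‖u t x‖) := by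
  sorry

/-- **stub 2 — `stub_periodicCriticalEndpoint` (KNOWN, deep: the ESS `L^{3,∞}` endpoint, local form,
periodic setting).** A classical solution of unforced NS_ν on `ℝ³ × [0,T)`, `0 < T`, with `u(t)` and
`p(t)` `ℤ³`-periodic on `[0,T)`, whose `L³(unit cell)` norm is bounded on `[0,T)`, has velocity bounded
on `[0,T) × ℝ³`. (Escauriaza–Seregin–Šverák 2003 Thm 1.4 on finitely many cylinders under the final
time + torus energy identity + Calderón–Zygmund for the mean-free periodic pressure; whole-space twin in
tree: `Literature.Analysis.FluidPDE.ess_endpoint`.) -/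
theorem stub_periodicCriticalEndpoint :
    ∀ ν : ℝ, 0 < ν → ∀ T : ℝ, 0 < T →
      ∀ (u : ℝ → EuclideanSpace ℝ (Fin 3) → EuclideanSpace ℝ (Fin 3))
        (p : ℝ → EuclideanSpace ℝ (Fin 3) → ℝ),
        Literature.Analysis.FluidPDE.IsClassicalNSSolutionOn (Set.Ico 0 T) ν 0 u p →
        (∀ t ∈ Set.Ico 0 T, Literature.Analysis.FluidPDE.IsLatticePeriodic (u t)) →
        (∀ t ∈ Set.Ico 0 T, Literature.Analysis.FluidPDE.IsLatticePeriodic (p t)) →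
        (∃ M : ℝ, ∀ t ∈ Set.Ico 0 T,
            eLpNorm (u t) 3 (volume.restrict
              {x : EuclideanSpace ℝ (Fin 3) | ∀ i, x i ∈ Set.Ico (0 : ℝ) 1}) ≤ ENNReal.ofReal M) →
        ∃ B : ℝ, ∀ t ∈ Set.Ico 0 T, ∀ x, ‖u t x‖ ≤ B := by
  sorry

/-- **stub 3 — `stub_periodicAPrioriL3` (OPEN — where Clay (B) lives: the a priori bound of the
critical norm in the normalised periodic class).** Every classical solution of unforced NS_ν on
`ℝ³ × [0,T)`, `0 < T`, with `u(t)` and `p(t)` `ℤ³`-periodic on `[0,T)`, has `L³(unit cell)` norm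
bounded on `[0,T)`. (Seregin 2012 Thm 1.1 / ESS 2003: the negation is exactly a periodic finite-time
singularity; Tao 2011 Thm 1.20 for the a-priori-bound reformulations at the `H¹` level.) -/
theorem stub_periodicAPrioriL3 :
    ∀ ν : ℝ, 0 < ν → ∀ T : ℝ, 0 < T →
      ∀ (u : ℝ → EuclideanSpace ℝ (Fin 3) → EuclideanSpace ℝ (Fin 3))
        (p : ℝ → EuclideanSpace ℝ (Fin 3) → ℝ),
        Literature.Analysis.FluidPDE.IsClassicalNSSolutionOn (Set.Ico 0 T) ν 0 u p →
        (∀ t ∈ Set.Ico 0 T, Literature.Analysis.FluidPDE.IsLatticePeriodic (u t)) →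
        (∀ t ∈ Set.Ico 0 T, Literature.Analysis.FluidPDE.IsLatticePeriodic (p t)) →
        ∃ M : ℝ, ∀ t ∈ Set.Ico 0 T,
          eLpNorm (u t) 3 (volume.restrict
            {x : EuclideanSpace ℝ (Fin 3) | ∀ i, x i ∈ Set.Ico (0 : ℝ) 1}) ≤ ENNReal.ofReal M := by
  sorry

/-- **Birth composition (the skeleton theorem): the crux BY NAME from the three registered stubs, used
by name; the ONLY theorem of this file concluding the crux, no `Prop` hypotheses.** Run the dichotomy
(stub 1); the global branch is a printed-(B) solution by the PROVED bridge
`isNavierStokesSolution_and_smooth_iff` (NSLerayHopf); in the finite branch the a priori `L³` bound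
(stub 3) feeds the critical endpoint (stub 2), whose velocity bound contradicts the unboundedness clause.
Placeholders: exactly the three `stub_*`; this proof carries none of its own (its closed twin with the
stub statements as hypotheses, `ClayB_of_hyps`, axioms propext/Classical.choice/Quot.sound, is the
registrar's folder evidence `bc/ClayB_birth_closed.lean`). -/
theorem ClayB_of : Theses.PeriodicPortability.ClayB := by
  intro ν hν u₀ hs hd hper
  rcases stub_periodicLocalDichotomy ν hν u₀ hs hd hper with
    ⟨u, p, hcl, h0, hup, hpp⟩ | ⟨T, hT, u, p, hcl, h0, hup, hpp, hunb⟩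
  · -- global branch: a classical solution on `[0,∞)` is a printed-(B) solution (proved bridge)
    obtain ⟨hns, hsu, hsp⟩ :=
      Literature.Analysis.FluidPDE.isNavierStokesSolution_and_smooth_iff.2 ⟨hcl, h0⟩
    exact ⟨u, p, hsu, hsp, hns, hup⟩
  · -- finite branch: a priori L³ bound ⇒ (critical endpoint) velocity bound ⇒ contradiction
    obtain ⟨M, hM⟩ := stub_periodicAPrioriL3 ν hν T hT u p hcl hup hpp
    obtain ⟨B, hB⟩ := stub_periodicCriticalEndpoint ν hν T hT u p hcl hup hpp ⟨M, hM⟩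
    obtain ⟨t, ht, x, hx⟩ := hunb B
    exact absurd (hB t ht x) (not_le.mpr hx)

end Summit.NavierStokesRegularity.NavierStokesRegularity.Cruxes.ClayB.Birth

end
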